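import Mathlib
import Summits.Ventures.PercRepro2.SwOutMixedPiecesDefs

/-!
# The m-piece big-block lemma on the face `f = ⊥`: the two cubes (blind cell PercRepro2,
night-4 g20, 2026-08-27; proofs/NIGHT4-G20.md §2)

On the face of the raw cube where every far arm is blue, the non-leaking points are the CORE cube
`coreM : (s, c) ↦ (s, const c, c, c, ⊥)` and the SLAB cube `tbM : (y, a, e) ↦ (const y, a, !y, e, ⊥)`
(`y = true` the T-slab, `y = false` the B-slab), which meet in exactly the two points
`z = (⊤, ⊥, 0, 0, ⊥)` and `z̄ = (⊥, ⊤, 1, 1, ⊥)` — an ANTIPODAL pair of the slab cube.  A lower set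
`Q` with `G5` meets the core cube in a lower set and the slab cube in a lower set (`G5` is the
lowerness in `y`).  This file: the faces `face T` and the partial flips `flipT T` (the far arms
outside `T` are never flipped) with the relative blue set `EBT T`, the two cubes with their
projections, the profile identities, and the lowerness of the two pieces
`SA Q` (the core points, `z` removed when `z ∈ Q`, `z̄ ∉ Q`) and `SB Q` (the rest).
-/

namespace Summit.Ventures.PercRepro2

namespace MixedPieces

open scoped Classical

variable {ι μ κ : Type*}

section Faces

/-- The face of the raw cube where the far arms outside `T` are blue. -/
def face (T : Finset κ) : Set (PtM ι μ κ) := {p | ∀ k, k ∉ T → p.2.2.2.2 k = false}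

/-- Every point lies on the full face. -/
lemma mem_face_univ [Fintype κ] (p : PtM ι μ κ) : p ∈ face Finset.univ := by
  intro k hk
  exact absurd (Finset.mem_univ k) hk

end Faces

section Flips

variable [DecidableEq κ]

/-- The partial flip: every coordinate except the far arms outside `T`. -/
def flipT (T : Finset κ) (p : PtM ι μ κ) : PtM ι μ κ :=
  (flipAll p.1, flipAll p.2.1, !p.2.2.1, !p.2.2.2.1,
    fun k => if k ∈ T then !p.2.2.2.2 k else p.2.2.2.2 k)

/-- The blue edge set relative to the face: the red set of the partial flip. -/
def EBT (T : Finset κ) (p : PtM ι μ κ) : Set (AtomM ι μ κ) := ER (flipT T p)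

/-- On the full face the partial flip is the total flip. -/
lemma flipT_univ [Fintype κ] (p : PtM ι μ κ) : flipT Finset.univ p = flipPt p := by
  obtain ⟨s, a, uP, e, f⟩ := p
  simp only [flipT, flipPt, Finset.mem_univ, if_true]
  rfl

/-- On the full face the relative blue set is the blue set. -/
lemma EBT_univ [Fintype κ] (p : PtM ι μ κ) : EBT Finset.univ p = EB p := by
  rw [EBT, flipT_univ]
  rfl

end Flips

section Cubes

/-- The core cube of the face `f = ⊥`: `(s, c) ↦ (s, const c, c, c, ⊥)`. -/
def coreM (x : Config (ι ⊕ Unit)) : PtM ι μ κ :=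
  (fun j => x (Sum.inl j), fun _ => x (Sum.inr ()), x (Sum.inr ()), x (Sum.inr ()),
    fun _ => false)

/-- The slab cube of the face `f = ⊥`: `(y, a, e) ↦ (const y, a, !y, e, ⊥)`. -/
def tbM (y : Config (Unit ⊕ (μ ⊕ Unit))) : PtM ι μ κ :=
  (fun _ => y (Sum.inl ()), fun i => y (Sum.inr (Sum.inl i)), !y (Sum.inl ()),
    y (Sum.inr (Sum.inr ())), fun _ => false)

/-- The projection onto the core cube: `(s, uP)`. -/
def projA (p : PtM ι μ κ) : Config (ι ⊕ Unit) := Sum.elim p.1 (fun _ => p.2.2.1)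

/-- The projection onto the slab cube: `(!uP, a, e)`. -/
def projB (p : PtM ι μ κ) : Config (Unit ⊕ (μ ⊕ Unit)) :=
  Sum.elim (fun _ => !p.2.2.1) (Sum.elim p.2.1 (fun _ => p.2.2.2.1))

/-- The point `z = (⊤, ⊥, 0, 0, ⊥)`. -/
def zPt : PtM ι μ κ := ((fun _ => true), (fun _ => false), false, false, fun _ => false)

/-- The point `z̄ = (⊥, ⊤, 1, 1, ⊥)`. -/
def zbPt : PtM ι μ κ := ((fun _ => false), (fun _ => true), true, true, fun _ => false)

/-- The two shared points differ. -/
lemma zPt_ne_zbPt : (zPt : PtM ι μ κ) ≠ zbPt := by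
  intro h
  have := congrArg (fun p : PtM ι μ κ => p.2.2.1) h
  simp only [zPt, zbPt] at this
  exact absurd this (by decide)

/-- The core projection inverts the core cube. -/
lemma projA_coreM (x : Config (ι ⊕ Unit)) : projA (coreM x : PtM ι μ κ) = x := by
  funext t
  rcases t with j | ⟨⟨⟩⟩ <;> rfl

/-- The slab projection inverts the slab cube. -/
lemma projB_tbM (y : Config (Unit ⊕ (μ ⊕ Unit))) : projB (tbM y : PtM ι μ κ) = y := by
  funext t
  rcases t with ⟨⟨⟩⟩ | i | ⟨⟨⟩⟩
  · simp only [projB, tbM, Sum.elim_inl, Bool.not_not]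
  · rfl
  · rfl

/-- A core point of the face is in the core cube. -/
lemma coreM_projA {p : PtM ι μ κ} (hc : Core p) (hf : p ∈ face ∅) : coreM (projA p) = p := by
  obtain ⟨s, a, uP, e, f⟩ := p
  obtain ⟨ha, hu⟩ := hc
  simp only at ha hu
  simp only [coreM, projA, Sum.elim_inl, Sum.elim_inr]
  refine Prod.ext rfl (Prod.ext ?_ (Prod.ext rfl (Prod.ext hu ?_)))
  · funext i
    exact (ha i).symm
  · funext k
    exact (hf k (Finset.notMem_empty k)).symm

/-- A slab point of the face is in the slab cube. -/
lemma tbM_projB {p : PtM ι μ κ} (hs : TSlab p ∨ BSlab p) (hf : p ∈ face ∅) :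
    tbM (projB p) = p := by
  obtain ⟨s, a, uP, e, f⟩ := p
  simp only [tbM, projB, Sum.elim_inl, Sum.elim_inr, Bool.not_not]
  refine Prod.ext ?_ (Prod.ext rfl (Prod.ext rfl (Prod.ext rfl ?_)))
  · rcases hs with ⟨hs, hu⟩ | ⟨hs, hu⟩
    · simp only at hs hu
      subst hu
      exact hs.symm
    · simp only at hs hu
      subst hu
      exact hs.symm
  · funext k
    exact (hf k (Finset.notMem_empty k)).symm

/-- The core cube lies on the face. -/
lemma coreM_mem_face (x : Config (ι ⊕ Unit)) : (coreM x : PtM ι μ κ) ∈ face ∅ := fun _ _ => rfl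

/-- The slab cube lies on the face. -/
lemma tbM_mem_face (y : Config (Unit ⊕ (μ ⊕ Unit))) : (tbM y : PtM ι μ κ) ∈ face ∅ :=
  fun _ _ => rfl

/-- The core cube consists of core points. -/
lemma core_coreM (x : Config (ι ⊕ Unit)) : Core (coreM x : PtM ι μ κ) := ⟨fun _ => rfl, rfl⟩

/-- The slab cube consists of slab points. -/
lemma slab_tbM (y : Config (Unit ⊕ (μ ⊕ Unit))) :
    TSlab (tbM y : PtM ι μ κ) ∨ BSlab (tbM y : PtM ι μ κ) := by
  cases h : y (Sum.inl ())
  · exact Or.inr ⟨by funext j; simp only [tbM, h], by simp only [tbM, h, Bool.not_false]⟩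
  · exact Or.inl ⟨by funext j; simp only [tbM, h], by simp only [tbM, h, Bool.not_true]⟩

/-- Core cube points are non-leaking. -/
lemma not_leak_coreM (x : Config (ι ⊕ Unit)) : ¬ Leak (coreM x : PtM ι μ κ) :=
  (not_leak_iff _).2 (Or.inl (core_coreM x))

/-- Slab cube points are non-leaking. -/
lemma not_leak_tbM (y : Config (Unit ⊕ (μ ⊕ Unit))) : ¬ Leak (tbM y : PtM ι μ κ) :=
  (not_leak_iff _).2 (Or.inr (slab_tbM y))

/-- The core cube is monotone. -/
lemma coreM_mono {x x' : Config (ι ⊕ Unit)} (h : x ≤ x') : (coreM x : PtM ι μ κ) ≤ coreM x' :=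
  ⟨fun j => h (Sum.inl j), fun _ => h (Sum.inr ()), h (Sum.inr ()), h (Sum.inr ()), fun _ => le_rfl⟩

/-- The red set along the slab cube is monotone (the u–p edges never count there). -/
lemma ER_tbM_mono {y y' : Config (Unit ⊕ (μ ⊕ Unit))} (h : y ≤ y') :
    ER (tbM y : PtM ι μ κ) ⊆ ER (tbM y') := by
  intro x hx
  rcases x with j | ⟨⟨⟩⟩ | i | ⟨⟨⟩⟩ | k
  · rw [mem_ER_inl] at hx ⊢
    exact true_le_imp (h (Sum.inl ())) hx
  · rw [mem_ER_u] at hx ⊢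
    obtain ⟨j, hj⟩ := hx
    exact ⟨j, true_le_imp (h (Sum.inl ())) hj⟩
  · rw [mem_ER_a] at hx ⊢
    exact true_le_imp (h (Sum.inr (Sum.inl i))) hx
  · rw [mem_ER_p] at hx ⊢
    obtain ⟨⟨j, hj⟩, hp⟩ := hx
    simp only [tbM] at hj hp
    rw [hj] at hp
    exact absurd hp (by decide)
  · rw [mem_ER_f] at hx ⊢
    exact hx

/-- The red set along the core cube is monotone. -/
lemma ER_coreM_mono {x x' : Config (ι ⊕ Unit)} (h : x ≤ x') :
    ER (coreM x : PtM ι μ κ) ⊆ ER (coreM x') := ER_mono (coreM_mono h)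

/-- A core point of the T-slab on the face is `z`. -/
lemma eq_zPt_of_core_tslab {p : PtM ι μ κ} (hc : Core p) (ht : TSlab p) (hf : p ∈ face ∅) :
    p = zPt := by
  obtain ⟨s, a, uP, e, f⟩ := p
  obtain ⟨ha, hu⟩ := hc
  obtain ⟨hs, hu'⟩ := ht
  simp only at ha hu hs hu'
  subst hu' hs
  simp only [zPt]
  refine Prod.ext rfl (Prod.ext ?_ (Prod.ext rfl (Prod.ext hu.symm ?_)))
  · funext i
    exact ha i
  · funext k
    exact hf k (Finset.notMem_empty k)

/-- A core point of the B-slab on the face is `z̄`. -/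
lemma eq_zbPt_of_core_bslab {p : PtM ι μ κ} (hc : Core p) (hb : BSlab p) (hf : p ∈ face ∅) :
    p = zbPt := by
  obtain ⟨s, a, uP, e, f⟩ := p
  obtain ⟨ha, hu⟩ := hc
  obtain ⟨hs, hu'⟩ := hb
  simp only at ha hu hs hu'
  subst hu' hs
  simp only [zbPt]
  refine Prod.ext rfl (Prod.ext ?_ (Prod.ext rfl (Prod.ext hu.symm ?_)))
  · funext i
    exact ha i
  · funext k
    exact hf k (Finset.notMem_empty k)

/-- `z` is a core point. -/
lemma core_zPt : Core (zPt : PtM ι μ κ) := ⟨fun _ => rfl, rfl⟩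

/-- `z̄` is a core point. -/
lemma core_zbPt : Core (zbPt : PtM ι μ κ) := ⟨fun _ => rfl, rfl⟩

/-- `z` is a T-slab point. -/
lemma tslab_zPt : TSlab (zPt : PtM ι μ κ) := ⟨rfl, rfl⟩

/-- `z̄` is a B-slab point. -/
lemma bslab_zbPt : BSlab (zbPt : PtM ι μ κ) := ⟨rfl, rfl⟩

/-- `z` lies on the face. -/
lemma zPt_mem_face : (zPt : PtM ι μ κ) ∈ face ∅ := fun _ _ => rfl

/-- `z̄` lies on the face. -/
lemma zbPt_mem_face : (zbPt : PtM ι μ κ) ∈ face ∅ := fun _ _ => rfl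

/-- The slab cube's form of a `G5` source. -/
lemma tbM_eq_of_true {y : Config (Unit ⊕ (μ ⊕ Unit))} (hy : y (Sum.inl ()) = true) :
    (tbM y : PtM ι μ κ) =
      ((fun _ => true), (fun i => y (Sum.inr (Sum.inl i))), false, y (Sum.inr (Sum.inr ())),
        fun _ => false) := by
  simp only [tbM, hy, Bool.not_true]

/-- The slab cube's form of a `G5` target. -/
lemma tbM_eq_of_false {y : Config (Unit ⊕ (μ ⊕ Unit))} (hy : y (Sum.inl ()) = false) :
    (tbM y : PtM ι μ κ) =
      ((fun _ => false), (fun i => y (Sum.inr (Sum.inl i))), true, y (Sum.inr (Sum.inr ())),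
        fun _ => false) := by
  simp only [tbM, hy, Bool.not_false]

/-- The red set of a slab point of the face is read off the slab cube. -/
lemma ER_eq_tbM_projB {p : PtM ι μ κ} (hf : p ∈ face ∅) (hs : TSlab p ∨ BSlab p) :
    ER p = ER (tbM (projB p)) := by
  rw [tbM_projB hs hf]

section Lower

variable {Q : Set (PtM ι μ κ)}

/-- Lowerness along the slab cube: below a point of `Q` in the slab cube, the cube stays in `Q`
(the raw order within a slab, `G5` across the slabs). -/
lemma tbM_mem_of_le (hQ : IsLowerSet Q) (hG : G5 Q) {y y' : Config (Unit ⊕ (μ ⊕ Unit))}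
    (hle : y ≤ y') (hy' : (tbM y' : PtM ι μ κ) ∈ Q) : (tbM y : PtM ι μ κ) ∈ Q := by
  have ha : ∀ i, y (Sum.inr (Sum.inl i)) ≤ y' (Sum.inr (Sum.inl i)) := fun i => hle _
  have he : y (Sum.inr (Sum.inr ())) ≤ y' (Sum.inr (Sum.inr ())) := hle _
  cases h0 : y (Sum.inl ()) <;> cases h0' : y' (Sum.inl ())
  · have hle' : (tbM y : PtM ι μ κ) ≤ tbM y' :=
      ⟨fun _ => hle _, ha, by simp only [tbM, h0, h0', le_refl], he, fun _ => le_rfl⟩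
    exact hQ hle' hy'
  · rw [tbM_eq_of_true h0'] at hy'
    have h1 := hG _ _ _ hy'
    have hle' : (tbM y : PtM ι μ κ) ≤
        ((fun _ => false), (fun i => y' (Sum.inr (Sum.inl i))), true, y' (Sum.inr (Sum.inr ())),
          fun _ => false) := by
      rw [tbM_eq_of_false h0]
      exact ⟨le_rfl, ha, le_rfl, he, le_rfl⟩
    exact hQ hle' h1
  · have := hle (Sum.inl ())
    rw [h0, h0'] at this
    exact absurd (true_le_imp this rfl) Bool.false_ne_true
  · have hle' : (tbM y : PtM ι μ κ) ≤ tbM y' :=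
      ⟨fun _ => hle _, ha, by simp only [tbM, h0, h0', le_refl], he, fun _ => le_rfl⟩
    exact hQ hle' hy'

/-- `F(⊤, 1) ∈ Q` forces `z̄ ∈ Q`: lower to `T(⊤, 1)` and apply `G5`. -/
lemma zbPt_mem_of_top_mem (hQ : IsLowerSet Q) (hG : G5 Q)
    (h : (((fun _ => true), (fun _ => true), true, true, fun _ => false) : PtM ι μ κ) ∈ Q) :
    (zbPt : PtM ι μ κ) ∈ Q := by
  have hle : (((fun _ => true), (fun _ => true), false, true, fun _ => false) : PtM ι μ κ) ≤
      ((fun _ => true), (fun _ => true), true, true, fun _ => false) :=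
    ⟨le_rfl, le_rfl, Bool.false_le _, le_rfl, le_rfl⟩
  exact hG _ _ _ (hQ hle h)

/-- `T(⊤, 1) ∈ Q` forces `z ∈ Q`. -/
lemma zPt_mem_of_tslab_top_mem (hQ : IsLowerSet Q)
    (h : (((fun _ => true), (fun _ => true), false, true, fun _ => false) : PtM ι μ κ) ∈ Q) :
    (zPt : PtM ι μ κ) ∈ Q := by
  have hle : (zPt : PtM ι μ κ) ≤
      ((fun _ => true), (fun _ => true), false, true, fun _ => false) :=
    ⟨le_rfl, fun _ => Bool.false_le _, le_rfl, Bool.false_le _, le_rfl⟩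
  exact hQ hle h

end Lower

end Cubes

section FlipCubes

variable [DecidableEq κ]

/-- The partial flip of the face commutes with the core cube. -/
lemma flipT_empty_coreM (x : Config (ι ⊕ Unit)) :
    flipT ∅ (coreM x : PtM ι μ κ) = coreM (flipAll x) := by
  refine Prod.ext ?_ (Prod.ext ?_ (Prod.ext rfl (Prod.ext rfl ?_)))
  · funext j
    rfl
  · funext i
    rfl
  · funext k
    simp only [flipT, coreM, Finset.notMem_empty, if_false]

/-- The partial flip of the face commutes with the slab cube. -/
lemma flipT_empty_tbM (y : Config (Unit ⊕ (μ ⊕ Unit))) :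
    flipT ∅ (tbM y : PtM ι μ κ) = tbM (flipAll y) := by
  refine Prod.ext ?_ (Prod.ext ?_ (Prod.ext ?_ (Prod.ext rfl ?_)))
  · funext j
    rfl
  · funext i
    rfl
  · simp only [flipT, tbM, flipAll, Bool.not_not]
  · funext k
    simp only [flipT, tbM, Finset.notMem_empty, if_false]

/-- The partial flip exchanges `z` and `z̄`. -/
lemma flipT_empty_zPt : flipT ∅ (zPt : PtM ι μ κ) = zbPt := by
  refine Prod.ext ?_ (Prod.ext ?_ (Prod.ext rfl (Prod.ext rfl ?_)))
  · funext j
    rfl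
  · funext i
    rfl
  · funext k
    simp only [flipT, zPt, zbPt, Finset.notMem_empty, if_false]

/-- The partial flip exchanges `z̄` and `z`. -/
lemma flipT_empty_zbPt : flipT ∅ (zbPt : PtM ι μ κ) = zPt := by
  refine Prod.ext ?_ (Prod.ext ?_ (Prod.ext rfl (Prod.ext rfl ?_)))
  · funext j
    rfl
  · funext i
    rfl
  · funext k
    simp only [flipT, zPt, zbPt, Finset.notMem_empty, if_false]

/-- The relative blue set of a slab point of the face is read off the flipped slab cube. -/
lemma EBT_eq_tbM_projB {p : PtM ι μ κ} (hf : p ∈ face ∅) (hs : TSlab p ∨ BSlab p) :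
    EBT ∅ p = ER (tbM (flipAll (projB p))) := by
  have h := tbM_projB hs hf
  conv_lhs => rw [← h]
  rw [EBT, flipT_empty_tbM]

/-- The relative blue set of a core point of the face is read off the flipped core cube. -/
lemma EBT_eq_coreM_projA {p : PtM ι μ κ} (hf : p ∈ face ∅) (hc : Core p) :
    EBT ∅ p = ER (coreM (flipAll (projA p))) := by
  have h := coreM_projA hc hf
  conv_lhs => rw [← h]
  rw [EBT, flipT_empty_coreM]

end FlipCubes

end MixedPieces

end Summit.Ventures.PercRepro2
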